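import Mathlib
import Summits.Ventures.HodgeRepro2.T5GaloisCartanThree
import Summits.Ventures.HodgeRepro2.T5ResidueFieldFinite

/-!
# The inert-place Hecke package from the base field's data alone

Blind cell `pub-hodge-repro2`, seat p8 (gen 13), Tier-5 kernel support.  `T5GaloisCartanThree`
states the inert-place Hecke package for `U(2,1)` under the Galois reading with two instance
arguments on the ring of integers upstairs — `IsDiscreteValuationRing 𝒪_E` and
`Finite (ResidueField 𝒪_E)`.  `T5UnramifiedUniformiser` reduces the first to «`𝒪_E` is local»
(`E / F` separable) and `T5ResidueFieldFinite` reduces the second to «the residue field of the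
BASE is finite».  This file puts the two together: every statement of the package holds for

* `R₀` a DVR with finite residue field and fraction field `F`,
* `E / F` finite separable with `𝒪_E = integralClosure R₀ E` LOCAL,
* `τ : E ≃ₐ[F] E` involutive (the star), `u ∈ R₀ˣ`, `𝔭_{R₀} 𝒪_E = 𝔭_{𝒪_E}` (`e = 1`),

i.e. from the data of the record's `F_v` and the two facts «one prime above `𝔭_{F_v}`» and
«`E_v / F_v` unramified»: `heckeAlgebra_mul_comm_galois_base` (commutativity),
`finrank_invariants_eq_one_galois_base` (multiplicity one),
`apply_heckeSMul_doubleCosetOp_eq_inv_galois_base` (adjointness) and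
`ncard_orbit_inv_eq_galois_base` (hU).

README §8(d): uses an L-value-free non-vanishing device: NO.
-/

namespace Summit.Ventures.HodgeRepro2.T5GaloisHeckeBase

open IsLocalRing T5StarOfInvolution T5UnramifiedUniformiser T5ResidueFieldFinite
  T5GaloisCartanThree

variable {R₀ F E : Type*} [CommRing R₀] [IsDomain R₀] [IsDiscreteValuationRing R₀] [Field F]
  [Field E] [Algebra R₀ F] [IsFractionRing R₀ F] [Algebra F E] [Algebra R₀ E]
  [IsScalarTower R₀ F E] [FiniteDimensional F E] [Algebra.IsSeparable F E]
  [IsLocalRing (integralClosure R₀ E)] [Finite (ResidueField R₀)]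
  (τ : E ≃ₐ[F] E) (hτ : ∀ x, τ (τ x) = x)

/-- **`H(U(2,1), K_U)` is commutative from the base's data**: `R₀` a DVR with finite residue
field, `E / F` finite separable, `𝒪_E` local, `e = 1`, the star the Galois conjugation. -/
theorem heckeAlgebra_mul_comm_galois_base
    (hunr : (maximalIdeal R₀).map (algebraMap R₀ (integralClosure R₀ E)) =
      maximalIdeal (integralClosure R₀ E)) (u : R₀ˣ) (k : Type*) [Field k] :
    letI := starRingOfInvolution (τ : E ≃+* E) hτ
    ∀ T S : T5HeckePermutationModule.heckeAlgebra k (T5UnitaryHeckeAdjoint.hyperspecialSubgroup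
      (integralClosure R₀ E) (T5HermitianThreeElements.J3 (algebraMap R₀ E (u : R₀)))),
      T * S = S * T := by
  haveI := isDiscreteValuationRing_integralClosure R₀ F E
  haveI := finite_residueField_integralClosure R₀ F E
  exact heckeAlgebra_mul_comm_galois τ hτ hunr u k

/-- **Spherical multiplicity one from the base's data.** -/
theorem finrank_invariants_eq_one_galois_base
    (hunr : (maximalIdeal R₀).map (algebraMap R₀ (integralClosure R₀ E)) =
      maximalIdeal (integralClosure R₀ E)) (u : R₀ˣ) {k : Type*} [Field k] [CharZero k]
    [IsAlgClosed k] {V : Type*} [AddCommGroup V] [Module k V] :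
    letI := starRingOfInvolution (τ : E ≃+* E) hτ
    ∀ (ρ : Representation k (T5UnitaryGroupForm.formUnitaryGroup
      (T5HermitianThreeElements.J3 (algebraMap R₀ E (u : R₀)))) V) [ρ.IsIrreducible],
      T5LevelIdempotent.KFinite ρ (T5UnitaryHeckeAdjoint.hyperspecialSubgroup (integralClosure R₀ E)
        (T5HermitianThreeElements.J3 (algebraMap R₀ E (u : R₀)))) →
      ∀ [FiniteDimensional k (LevelPositivity.invariants ρ (T5UnitaryHeckeAdjoint.hyperspecialSubgroup
        (integralClosure R₀ E) (T5HermitianThreeElements.J3 (algebraMap R₀ E (u : R₀)))))],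
      LevelPositivity.invariants ρ (T5UnitaryHeckeAdjoint.hyperspecialSubgroup (integralClosure R₀ E)
        (T5HermitianThreeElements.J3 (algebraMap R₀ E (u : R₀)))) ≠ ⊥ →
      Module.finrank k (LevelPositivity.invariants ρ (T5UnitaryHeckeAdjoint.hyperspecialSubgroup
        (integralClosure R₀ E) (T5HermitianThreeElements.J3 (algebraMap R₀ E (u : R₀))))) = 1 := by
  haveI := isDiscreteValuationRing_integralClosure R₀ F E
  haveI := finite_residueField_integralClosure R₀ F E
  exact finrank_invariants_eq_one_galois τ hτ hunr u

/-- **Adjointness `B(T_g v, w) = B(v, T_{g⁻¹} w)` from the base's data.** -/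
theorem apply_heckeSMul_doubleCosetOp_eq_inv_galois_base
    (hunr : (maximalIdeal R₀).map (algebraMap R₀ (integralClosure R₀ E)) =
      maximalIdeal (integralClosure R₀ E)) (u : R₀ˣ) {k : Type*} [Field k] [StarRing k]
    {V : Type*} [AddCommGroup V] [Module k V] :
    letI := starRingOfInvolution (τ : E ≃+* E) hτ
    haveI : IsFractionRing (integralClosure R₀ E) E :=
      integralClosure.isFractionRing_of_finite_extension F E
    haveI : IsDiscreteValuationRing (integralClosure R₀ E) :=
      isDiscreteValuationRing_integralClosure R₀ F E
    haveI : Finite (ResidueField (integralClosure R₀ E)) :=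
      finite_residueField_integralClosure R₀ F E
    ∀ {ρ : Representation k (T5UnitaryGroupForm.formUnitaryGroup
        (T5HermitianThreeElements.J3 (algebraMap R₀ E (u : R₀)))) V}
      {B : V →ₗ⋆[k] V →ₗ[k] k}, T5HeckeAdjointHermitian.IsInvariantSesq ρ B →
      T5HeckeAdjointHermitian.IsHermitian B →
      ∀ (g : T5UnitaryGroupForm.formUnitaryGroup
          (T5HermitianThreeElements.J3 (algebraMap R₀ E (u : R₀))))
        (v w : LevelPositivity.invariants ρ (T5UnitaryHeckeAdjoint.hyperspecialSubgroup
          (integralClosure R₀ E) (T5HermitianThreeElements.J3 (algebraMap R₀ E (u : R₀))))),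
        B (T5HeckePermutationModule.heckeSMul ρ (T5HeckeDoubleCoset.doubleCosetOp k
          (T5UnitaryHeckeAdjoint.hyperspecialSubgroup (integralClosure R₀ E)
            (T5HermitianThreeElements.J3 (algebraMap R₀ E (u : R₀)))) g) v) w =
        B v (T5HeckePermutationModule.heckeSMul ρ (T5HeckeDoubleCoset.doubleCosetOp k
          (T5UnitaryHeckeAdjoint.hyperspecialSubgroup (integralClosure R₀ E)
            (T5HermitianThreeElements.J3 (algebraMap R₀ E (u : R₀)))) g⁻¹) w) := by
  haveI := isDiscreteValuationRing_integralClosure R₀ F E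
  haveI := finite_residueField_integralClosure R₀ F E
  intro ρ B hB hH g v w
  exact apply_heckeSMul_doubleCosetOp_eq_inv_galois τ hτ hunr u hB hH g v w

omit [Finite (ResidueField R₀)] in
/-- `#(K g⁻¹ K / K) = #(K g K / K)` from the base's data (no residue-field hypothesis). -/
theorem ncard_orbit_inv_eq_galois_base
    (hunr : (maximalIdeal R₀).map (algebraMap R₀ (integralClosure R₀ E)) =
      maximalIdeal (integralClosure R₀ E)) (u : R₀ˣ) :
    letI := starRingOfInvolution (τ : E ≃+* E) hτ
    ∀ g : T5UnitaryGroupForm.formUnitaryGroup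
      (T5HermitianThreeElements.J3 (algebraMap R₀ E (u : R₀))),
      (MulAction.orbit (T5UnitaryHeckeAdjoint.hyperspecialSubgroup (integralClosure R₀ E)
        (T5HermitianThreeElements.J3 (algebraMap R₀ E (u : R₀))))
        (QuotientGroup.mk g⁻¹ : _ ⧸ T5UnitaryHeckeAdjoint.hyperspecialSubgroup (integralClosure R₀ E)
          (T5HermitianThreeElements.J3 (algebraMap R₀ E (u : R₀))))).ncard =
      (MulAction.orbit (T5UnitaryHeckeAdjoint.hyperspecialSubgroup (integralClosure R₀ E)
        (T5HermitianThreeElements.J3 (algebraMap R₀ E (u : R₀))))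
        (QuotientGroup.mk g : _ ⧸ T5UnitaryHeckeAdjoint.hyperspecialSubgroup (integralClosure R₀ E)
          (T5HermitianThreeElements.J3 (algebraMap R₀ E (u : R₀))))).ncard := by
  haveI := isDiscreteValuationRing_integralClosure R₀ F E
  exact ncard_orbit_inv_eq_galois τ hτ hunr u

end Summit.Ventures.HodgeRepro2.T5GaloisHeckeBase
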